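import Summits.ValiantsHypothesis.ValiantsHypothesis.Theorems.LacunarySymmetroidMatrixDescartesCensusDoorA34NullNullSeventeenAnatomy
import Summits.ValiantsHypothesis.ValiantsHypothesis.Theorems.LacunarySymmetroidMatrixDescartesCensusFullAlternation

/-!
# `MatrixDescartes` census — DOOR A at `(3,4)`: END-PARITY LAWS of the two null sheets — an eighteen on the null-top sheet needs
# `det S₀ · tr(adj S₃·S₂) > 0` and `det S₀ · tr(adj S₀·S₁) < 0`; a seventeen on the null-null sheet needs `tr(adj S₀·S₁) · tr(adj S₃·S₂) < 0`.
# Hence `stub_nullTopCeiling` HOLDS on the closed half-sheet `det S₀ · tr(adj S₃·S₂) ≤ 0` and `stub_nullNullCeiling` on `tr(adj S₀·S₁)·tr(adj S₃·S₂) ≥ 0`.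

HONEST FRAMING.  Object-search cell `pub-symmetroid`, engine seat `val-sym-eng-2` (g4); helper rows beside the registered strata line
`Cruxes/DoorA34/Lines/strata.lean` on stmt-ValiantsHypothesis-19980 (`DoorA34 = PosRootLawAt 3 4 18`: OPEN, typed, never asserted here).
By `…NullTopEighteenAnatomy` / `…NullNullSeventeenAnatomy` (this seat) a counterexample to `stub_nullTopCeiling` (resp. `stub_nullNullCeiling`) on a sorted
support is DESCARTES-SHARP on its sheet: all `19` (resp. `18`) slot exponents present and distinct, `18` (resp. `17`) roots.  The cell's F1 row
(`Census.pow_rank_mul_coeff_mul_coeff_pos_of_sharp`, …CensusFullAlternation) then fixes the sign of every coefficient up to one global sign by the PARITY OF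
ITS RANK in the exponent order.  Two ranks are chamber-free on every sorted support: the BOTTOM slot `{0,0,0}` (exponent `3d₀`, coefficient `det S₀`,
rank `0`), the next one `{0,0,1}` (`2d₀+d₁`, coefficient `tr(adj S₀·S₁)`, rank `1`), and the TOP slot of the sheet `{3,3,2}` (`2d₃+d₂`, coefficient
`tr(adj S₃·S₂)`, rank `18` on the null-top sheet / `17` on the null-null sheet, where `{0,0,1}` has rank `0`).  Hence, for ANY real letters:

* `sym_sum_le_subtop_of_strictMono`, `bottom_le_sym_sum` — slot exponents lie in `[3d₀, 2d₃+d₂]` off the top cube (sorted support);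
* **`det_bottom_mul_trace_top_pos_of_nullTop_eighteen`** — `StrictMono d`, `det S₃ = 0`, `18` roots ⇒ `0 < det S₀ · tr(adj S₃·S₂)`;
  **`det_bottom_mul_trace_bottom_neg_of_nullTop_eighteen`** — … ⇒ `det S₀ · tr(adj S₀·S₁) < 0`;
* **`posRoots_le_17_of_nullTop_of_endProduct_nonpos`** — the HALF-SHEET CLOSURE: `StrictMono d`, `det S₃ = 0`, `det S₀ · tr(adj S₃·S₂) ≤ 0` ⇒ `≤ 17`
  (the stub holds on the closed half of its open sheet; the exact seventeens of record p559152 / p584238 have `det S₀ · tr(adj S₃·S₂) < 0` indeed, and an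
  eighteen must sit in the OTHER half); `posRoots_le_17_of_nullTop_of_bottomProduct_nonneg` (`det S₀ · tr(adj S₀·S₁) ≥ 0 ⇒ ≤ 17`);
* **`trace_bottom_mul_trace_top_neg_of_nullNull_seventeen`**, **`posRoots_le_16_of_nullNull_of_endProduct_nonneg`** — the null-null sheet:
  `tr(adj S₀·S₁) · tr(adj S₃·S₂) ≥ 0 ⇒ ≤ 16`.

Nothing here bounds anything on the remaining open half-sheets; `DoorA34` and the three stubs stay OPEN; registers unchanged; nothing on `MatrixDescartes`
(stmt-ValiantsHypothesis-18050) or `VP ≠ VNP` — VP≠VNP not moved.  [folklore] Descartes' rule of signs, sharp case (sign alternation); elementary.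
-/

-- `Summit.ValiantsHypothesis.ValiantsHypothesis.…` repeats a component by the D-0017 layout
-- (single-conjunct summit), which the `dupNamespace` linter flags; the name is mandated.
set_option linter.dupNamespace false

namespace Summit.ValiantsHypothesis.ValiantsHypothesis.Theorems.LacunarySymmetroidMatrixDescartes.Census

open Polynomial Finset
open scoped BigOperators Polynomial Matrix

/-- Off the top cube every slot exponent is `≤ 2d₃ + d₂` on a sorted support. [folklore] -/
theorem sym_sum_le_subtop_of_strictMono (d : Fin 4 → ℕ) (hd : StrictMono d) (s : Sym (Fin 4) 3) (hs : s ≠ Sym.replicate 3 3) :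
    ((s : Multiset (Fin 4)).map d).sum ≤ 2 * d 3 + d 2 := by
  have hle : ∀ l : Fin 4, d l ≤ d 3 := fun l => hd.monotone (Fin.le_last l)
  obtain ⟨a, ha, ha3⟩ : ∃ a ∈ (s : Multiset (Fin 4)), a ≠ 3 := by
    by_contra hall
    exact hs (Sym.eq_replicate_iff.2 fun b hb => by
      by_contra hb3
      exact hall ⟨b, hb, hb3⟩)
  obtain ⟨t, ht⟩ := Multiset.exists_cons_of_mem ha
  have hcard : Multiset.card t = 2 := by
    have hcs : Multiset.card (s : Multiset (Fin 4)) = 3 := Sym.card_coe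
    rw [ht, Multiset.card_cons] at hcs
    omega
  have ha2 : a ≤ 2 := by
    have h3 : (a : ℕ) ≠ 3 := fun h => ha3 (Fin.ext h)
    have := a.2
    show (a : ℕ) ≤ 2
    omega
  have hda : d a ≤ d 2 := hd.monotone ha2
  have hsum_t : (t.map d).sum ≤ 2 * d 3 := by
    have h := Multiset.sum_le_card_nsmul (t.map d) (d 3) (by
      intro x hx
      obtain ⟨l, -, rfl⟩ := Multiset.mem_map.mp hx
      exact hle l)
    simpa [hcard] using h
  rw [ht, Multiset.map_cons, Multiset.sum_cons]
  omega

/-- Every slot exponent is `≥ 3d₀` on a sorted support. [folklore] -/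
theorem bottom_le_sym_sum_of_strictMono (d : Fin 4 → ℕ) (hd : StrictMono d) (s : Sym (Fin 4) 3) :
    3 * d 0 ≤ ((s : Multiset (Fin 4)).map d).sum := by
  have hle : ∀ l : Fin 4, d 0 ≤ d l := fun l => hd.monotone (Fin.zero_le l)
  have h := Multiset.card_nsmul_le_sum (s := (s : Multiset (Fin 4)).map d) (a := d 0) (by
    intro x hx
    obtain ⟨l, -, rfl⟩ := Multiset.mem_map.mp hx
    exact hle l)
  simpa [Sym.card_coe] using h

/-- The slot `{3,3,2}` and its exponent `2d₃ + d₂`. [folklore] -/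
theorem sym_sum_332 (d : Fin 4 → ℕ) (h : Multiset.card ({3, 3, 2} : Multiset (Fin 4)) = 3) :
    ((((⟨{3, 3, 2}, h⟩ : Sym (Fin 4) 3)) : Multiset (Fin 4)).map d).sum = 2 * d 3 + d 2 := by
  simp only [Multiset.insert_eq_cons, Multiset.map_cons, Multiset.sum_cons, Multiset.map_singleton, Multiset.sum_singleton]
  ring

/-- The slot `{0,0,1}` and its exponent `2d₀ + d₁`. [folklore] -/
theorem sym_sum_001 (d : Fin 4 → ℕ) (h : Multiset.card ({0, 0, 1} : Multiset (Fin 4)) = 3) :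
    ((((⟨{0, 0, 1}, h⟩ : Sym (Fin 4) 3)) : Multiset (Fin 4)).map d).sum = 2 * d 0 + d 1 := by
  simp only [Multiset.insert_eq_cons, Multiset.map_cons, Multiset.sum_cons, Multiset.map_singleton, Multiset.sum_singleton]
  ring

/-- On a sorted support, a slot other than `{0,0,0}` and `{0,0,1}` has exponent `> 2d₀ + d₁`. [folklore] -/
theorem subbottom_lt_sym_sum_of_strictMono (d : Fin 4 → ℕ) (hd : StrictMono d) (s : Sym (Fin 4) 3) (hs0 : s ≠ Sym.replicate 3 0)
    (hs1 : (s : Multiset (Fin 4)) ≠ {0, 0, 1}) : 2 * d 0 + d 1 < ((s : Multiset (Fin 4)).map d).sum := by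
  have h01 : d 0 < d 1 := hd (by decide)
  have h12 : d 1 < d 2 := hd (by decide)
  have hle0 : ∀ l : Fin 4, d 0 ≤ d l := fun l => hd.monotone (Fin.zero_le l)
  obtain ⟨a, ha, ha0⟩ : ∃ a ∈ (s : Multiset (Fin 4)), a ≠ 0 := by
    by_contra hall
    exact hs0 (Sym.eq_replicate_iff.2 fun b hb => by
      by_contra hb0
      exact hall ⟨b, hb, hb0⟩)
  obtain ⟨t, ht⟩ := Multiset.exists_cons_of_mem ha
  have hcard : Multiset.card t = 2 := by
    have hcs : Multiset.card (s : Multiset (Fin 4)) = 3 := Sym.card_coe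
    rw [ht, Multiset.card_cons] at hcs
    omega
  have ht0 : 2 * d 0 ≤ (t.map d).sum := by
    have h := Multiset.card_nsmul_le_sum (s := t.map d) (a := d 0) (by
      intro x hx
      obtain ⟨l, -, rfl⟩ := Multiset.mem_map.mp hx
      exact hle0 l)
    simpa [hcard] using h
  rw [ht, Multiset.map_cons, Multiset.sum_cons]
  have ha1 : (1 : Fin 4) ≤ a := by
    have : (a : ℕ) ≠ 0 := fun h => ha0 (Fin.ext h)
    show (1 : ℕ) ≤ (a : ℕ)
    omega
  by_cases ha2 : (2 : Fin 4) ≤ a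
  · have hda : d 2 ≤ d a := hd.monotone ha2
    omega
  · have hda : d 1 ≤ d a := hd.monotone ha1
    -- here `a = 1`; the tail `t` is not `{0,0}` (else `s = {0,0,1}`), so it carries an element `≥ 1`
    have ha_eq : a = 1 := le_antisymm (by
      have : (a : ℕ) < 2 := by
        by_contra h
        exact ha2 (show (2 : ℕ) ≤ (a : ℕ) by omega)
      show (a : ℕ) ≤ 1
      omega) ha1
    subst ha_eq
    obtain ⟨b, hb, hb0⟩ : ∃ b ∈ t, b ≠ 0 := by
      by_contra hall
      have ht00 : t = Multiset.replicate 2 0 :=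
        Multiset.eq_replicate.2 ⟨hcard, fun b hb => by
          by_contra hb0
          exact hall ⟨b, hb, hb0⟩⟩
      apply hs1
      rw [ht, ht00]
      decide
    obtain ⟨u, hu⟩ := Multiset.exists_cons_of_mem hb
    have hcu : Multiset.card u = 1 := by
      rw [hu, Multiset.card_cons] at hcard
      omega
    have hu0 : d 0 ≤ (u.map d).sum := by
      have h := Multiset.card_nsmul_le_sum (s := u.map d) (a := d 0) (by
        intro x hx
        obtain ⟨l, -, rfl⟩ := Multiset.mem_map.mp hx
        exact hle0 l)
      simpa [hcu] using h
    have hb1 : (1 : Fin 4) ≤ b := by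
      have : (b : ℕ) ≠ 0 := fun h => hb0 (Fin.ext h)
      show (1 : ℕ) ≤ (b : ℕ)
      omega
    have hdb : d 1 ≤ d b := hd.monotone hb1
    rw [hu, Multiset.map_cons, Multiset.sum_cons]
    omega

/-- A `Sym` built from an explicit multiset differs from a replicate when the multisets differ. [folklore] -/
theorem sym_mk_ne_replicate {m : Multiset (Fin 4)} (h : Multiset.card m = 3) (c : Fin 4) (hm : m ≠ Multiset.replicate 3 c) :
    (⟨m, h⟩ : Sym (Fin 4) 3) ≠ Sym.replicate 3 c := fun e =>
  hm (by simpa [Sym.coe_replicate] using congrArg (fun u : Sym (Fin 4) 3 => (u : Multiset (Fin 4))) e)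

/-- **Coefficient dictionary at the three chamber-free slots of a null-top eighteen**: `coeff(3d₀) = det S₀`, `coeff(2d₀+d₁) = tr(adj S₀·S₁)`,
`coeff(2d₃+d₂) = tr(adj S₃·S₂)`. [folklore] -/
theorem coeff_ends_of_nullTop_eighteen (d : Fin 4 → ℕ) (hd : StrictMono d) (S : Fin 4 → Matrix (Fin 3) (Fin 3) ℝ) (h3 : (S 3).det = 0)
    (h18 : 18 ≤ ((Matrix.det (∑ l, ((X : ℝ[X]) ^ d l) • (S l).map C)).roots.toFinset.filter (fun t => 0 < t)).card) :
    (Matrix.det (∑ l, ((X : ℝ[X]) ^ d l) • (S l).map C)).coeff (3 * d 0) = (S 0).det ∧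
    (Matrix.det (∑ l, ((X : ℝ[X]) ^ d l) • (S l).map C)).coeff (2 * d 0 + d 1) = ((S 0).adjugate * S 1).trace ∧
    (Matrix.det (∑ l, ((X : ℝ[X]) ^ d l) • (S l).map C)).coeff (2 * d 3 + d 2) = ((S 3).adjugate * S 2).trace := by
  have h332 : Multiset.card ({3, 3, 2} : Multiset (Fin 4)) = 3 := by simp
  have h001 : Multiset.card ({0, 0, 1} : Multiset (Fin 4)) = 3 := by simp
  have hr0 : Sym.replicate 3 (0 : Fin 4) ≠ Sym.replicate 3 3 := by decide
  have hσ0 : (((Sym.replicate 3 (0 : Fin 4) : Sym (Fin 4) 3) : Multiset (Fin 4)).map d).sum = 3 * d 0 := by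
    simp only [Sym.coe_replicate, Multiset.map_replicate, Multiset.sum_replicate, smul_eq_mul]
  refine ⟨?_, ?_, ?_⟩
  · refine coeff_det_pencil_three_mul d S 0 fun f hf i => ?_
    exact fun_const_of_sym_eq_replicate f 0 (sym_eq_of_sum_eq_of_nullTop_eighteen d hd S h3 h18 _ hr0 f (hf.trans hσ0.symm)) i
  · have hs : (⟨{0, 0, 1}, h001⟩ : Sym (Fin 4) 3) ≠ Sym.replicate 3 3 := sym_mk_ne_replicate h001 3 (by decide)
    refine coeff_det_pencil_three_square d S (by decide : (0 : Fin 4) ≠ 1) fun f hf => ?_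
    have h := sym_eq_of_sum_eq_of_nullTop_eighteen d hd S h3 h18 _ hs f (hf.trans (sym_sum_001 d h001).symm)
    have hval : (Finset.univ.val.map f : Multiset (Fin 4)) = {0, 0, 1} := by
      have := congrArg (fun u : Sym (Fin 4) 3 => (u : Multiset (Fin 4))) h
      simpa using this
    exact fun_eq_of_map_univ_eq_pair 0 1 (by decide) f hval
  · have hs : (⟨{3, 3, 2}, h332⟩ : Sym (Fin 4) 3) ≠ Sym.replicate 3 3 := sym_mk_ne_replicate h332 3 (by decide)
    refine coeff_det_pencil_three_square d S (by decide : (3 : Fin 4) ≠ 2) fun f hf => ?_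
    have h := sym_eq_of_sum_eq_of_nullTop_eighteen d hd S h3 h18 _ hs f (hf.trans (sym_sum_332 d h332).symm)
    have hval : (Finset.univ.val.map f : Multiset (Fin 4)) = {3, 3, 2} := by
      have := congrArg (fun u : Sym (Fin 4) 3 => (u : Multiset (Fin 4))) h
      simpa using this
    exact fun_eq_of_map_univ_eq_pair 3 2 (by decide) f hval

/-- **END-PARITY LAW OF THE NULL-TOP SHEET.**  On a sorted support, `det S₃ = 0` and `18` distinct positive roots force `det S₀ · tr(adj S₃·S₂) > 0`
(the bottom coefficient and the top surviving coefficient have the same sign: `Var = 18` is even).  Any real letters. [folklore] -/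
theorem det_bottom_mul_trace_top_pos_of_nullTop_eighteen (d : Fin 4 → ℕ) (hd : StrictMono d) (S : Fin 4 → Matrix (Fin 3) (Fin 3) ℝ)
    (h3 : (S 3).det = 0)
    (h18 : 18 ≤ ((Matrix.det (∑ l, ((X : ℝ[X]) ^ d l) • (S l).map C)).roots.toFinset.filter (fun t => 0 < t)).card) :
    0 < (S 0).det * ((S 3).adjugate * S 2).trace := by
  have h332 : Multiset.card ({3, 3, 2} : Multiset (Fin 4)) = 3 := by simp
  set P := Matrix.det (∑ l, ((X : ℝ[X]) ^ d l) • (S l).map C) with hP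
  have hsupp := support_det_pencil_eq_of_nullTop_eighteen d S h3 h18
  have hcard : P.support.card = 19 := by
    rw [hP, hsupp, Finset.card_image_iff.mpr (sym_sum_injOn_of_nullTop_eighteen d S h3 h18),
      Finset.card_erase_of_mem (Finset.mem_univ _), Finset.card_univ, Sym.card_sym_eq_choose]
    decide
  obtain ⟨hc0, -, hc2⟩ := coeff_ends_of_nullTop_eighteen d hd S h3 h18
  -- membership of the two end exponents
  have hr0 : Sym.replicate 3 (0 : Fin 4) ≠ Sym.replicate 3 3 := by decide
  have hs2 : (⟨{3, 3, 2}, h332⟩ : Sym (Fin 4) 3) ≠ Sym.replicate 3 3 := sym_mk_ne_replicate h332 3 (by decide)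
  have hmem0 : 3 * d 0 ∈ P.support := by
    have := coeff_sym_sum_ne_zero_of_nullTop_eighteen d S h3 h18 _ hr0
    simp only [Sym.coe_replicate, Multiset.map_replicate, Multiset.sum_replicate, smul_eq_mul] at this
    exact mem_support_iff.mpr this
  have hmem2 : 2 * d 3 + d 2 ∈ P.support := by
    rw [hP, hsupp]
    exact Finset.mem_image.mpr ⟨_, Finset.mem_erase.mpr ⟨hs2, Finset.mem_univ _⟩, sym_sum_332 d h332⟩
  -- ranks: nothing below `3d₀`, everything but the top below `2d₃ + d₂`
  have hrank0 : (P.support.filter (fun c => c < 3 * d 0)).card = 0 := by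
    rw [Finset.card_eq_zero, Finset.filter_eq_empty_iff]
    intro c hc
    rw [hP, hsupp] at hc
    obtain ⟨s, -, rfl⟩ := Finset.mem_image.mp hc
    exact not_lt.mpr (bottom_le_sym_sum_of_strictMono d hd s)
  have hrank2 : (P.support.filter (fun c => c < 2 * d 3 + d 2)).card = 18 := by
    have hfilt : P.support.filter (fun c => c < 2 * d 3 + d 2) = P.support.erase (2 * d 3 + d 2) := by
      ext c
      simp only [Finset.mem_filter, Finset.mem_erase]
      constructor
      · rintro ⟨hc, hlt⟩; exact ⟨Nat.ne_of_lt hlt, hc⟩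
      · rintro ⟨hne, hc⟩
        refine ⟨hc, lt_of_le_of_ne ?_ hne⟩
        rw [hP, hsupp] at hc
        obtain ⟨s, hs, rfl⟩ := Finset.mem_image.mp hc
        exact sym_sum_le_subtop_of_strictMono d hd s (Finset.mem_erase.mp hs).1
    rw [hfilt, Finset.card_erase_of_mem hmem2, hcard]
  have key := pow_rank_mul_coeff_mul_coeff_pos_of_sharp P (by rw [hcard]; omega) hmem0 hmem2
  rw [hrank0, hrank2, hc0, hc2] at key
  norm_num at key
  exact key

/-- **Second end-parity law of the null-top sheet**: `18` roots force `det S₀ · tr(adj S₀·S₁) < 0` (consecutive bottom coefficients alternate). [folklore] -/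
theorem det_bottom_mul_trace_bottom_neg_of_nullTop_eighteen (d : Fin 4 → ℕ) (hd : StrictMono d) (S : Fin 4 → Matrix (Fin 3) (Fin 3) ℝ)
    (h3 : (S 3).det = 0)
    (h18 : 18 ≤ ((Matrix.det (∑ l, ((X : ℝ[X]) ^ d l) • (S l).map C)).roots.toFinset.filter (fun t => 0 < t)).card) :
    (S 0).det * ((S 0).adjugate * S 1).trace < 0 := by
  have h001 : Multiset.card ({0, 0, 1} : Multiset (Fin 4)) = 3 := by simp
  set P := Matrix.det (∑ l, ((X : ℝ[X]) ^ d l) • (S l).map C) with hP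
  have hsupp := support_det_pencil_eq_of_nullTop_eighteen d S h3 h18
  have hcard : P.support.card = 19 := by
    rw [hP, hsupp, Finset.card_image_iff.mpr (sym_sum_injOn_of_nullTop_eighteen d S h3 h18),
      Finset.card_erase_of_mem (Finset.mem_univ _), Finset.card_univ, Sym.card_sym_eq_choose]
    decide
  obtain ⟨hc0, hc1, -⟩ := coeff_ends_of_nullTop_eighteen d hd S h3 h18
  have hr0 : Sym.replicate 3 (0 : Fin 4) ≠ Sym.replicate 3 3 := by decide
  have hs1 : (⟨{0, 0, 1}, h001⟩ : Sym (Fin 4) 3) ≠ Sym.replicate 3 3 := sym_mk_ne_replicate h001 3 (by decide)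
  have hmem0 : 3 * d 0 ∈ P.support := by
    have := coeff_sym_sum_ne_zero_of_nullTop_eighteen d S h3 h18 _ hr0
    simp only [Sym.coe_replicate, Multiset.map_replicate, Multiset.sum_replicate, smul_eq_mul] at this
    exact mem_support_iff.mpr this
  have hmem1 : 2 * d 0 + d 1 ∈ P.support := by
    rw [hP, hsupp]
    exact Finset.mem_image.mpr ⟨_, Finset.mem_erase.mpr ⟨hs1, Finset.mem_univ _⟩, sym_sum_001 d h001⟩
  have h01 : 3 * d 0 < 2 * d 0 + d 1 := by have := hd (show (0 : Fin 4) < 1 by decide); omega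
  have hcons : ∀ c ∈ P.support, ¬ (3 * d 0 < c ∧ c < 2 * d 0 + d 1) := by
    intro c hc ⟨hlo, hhi⟩
    rw [hP, hsupp] at hc
    obtain ⟨s, hs, rfl⟩ := Finset.mem_image.mp hc
    by_cases hs0 : s = Sym.replicate 3 0
    · subst hs0
      simp only [Sym.coe_replicate, Multiset.map_replicate, Multiset.sum_replicate, smul_eq_mul] at hlo
      omega
    by_cases hs1' : s = (⟨{0, 0, 1}, h001⟩ : Sym (Fin 4) 3)
    · subst hs1'; exact lt_irrefl _ ((sym_sum_001 d h001).symm.trans_lt hhi)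
    have := subbottom_lt_sym_sum_of_strictMono d hd s hs0 (fun h => hs1' (Subtype.ext h))
    omega
  have key := coeff_mul_coeff_neg_of_sharp P (by rw [hcard]; omega) hmem0 hmem1 h01 hcons
  rw [hc0, hc1] at key
  exact key

/-- **HALF-SHEET CLOSURE of `stub_nullTopCeiling`.**  On a sorted support with `det S₃ = 0`: if `det S₀ · tr(adj S₃·S₂) ≤ 0` then at most `17`
distinct positive roots (any real letters). [folklore] -/
theorem posRoots_le_17_of_nullTop_of_endProduct_nonpos (d : Fin 4 → ℕ) (hd : StrictMono d) (S : Fin 4 → Matrix (Fin 3) (Fin 3) ℝ)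
    (h3 : (S 3).det = 0) (hsign : (S 0).det * ((S 3).adjugate * S 2).trace ≤ 0) :
    ((Matrix.det (∑ l, ((X : ℝ[X]) ^ d l) • (S l).map C)).roots.toFinset.filter (fun t => 0 < t)).card ≤ 17 := by
  by_contra h
  have := det_bottom_mul_trace_top_pos_of_nullTop_eighteen d hd S h3 (by omega)
  linarith

/-- **Bottom-pair closure of `stub_nullTopCeiling`.**  On a sorted support with `det S₃ = 0`: if `det S₀ · tr(adj S₀·S₁) ≥ 0` then at most `17`
distinct positive roots. [folklore] -/
theorem posRoots_le_17_of_nullTop_of_bottomProduct_nonneg (d : Fin 4 → ℕ) (hd : StrictMono d) (S : Fin 4 → Matrix (Fin 3) (Fin 3) ℝ)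
    (h3 : (S 3).det = 0) (hsign : 0 ≤ (S 0).det * ((S 0).adjugate * S 1).trace) :
    ((Matrix.det (∑ l, ((X : ℝ[X]) ^ d l) • (S l).map C)).roots.toFinset.filter (fun t => 0 < t)).card ≤ 17 := by
  by_contra h
  have := det_bottom_mul_trace_bottom_neg_of_nullTop_eighteen d hd S h3 (by omega)
  linarith

/-- **END-PARITY LAW OF THE NULL-NULL SHEET.**  On a sorted support, `det S₀ = det S₃ = 0` and `17` distinct positive roots force
`tr(adj S₀·S₁) · tr(adj S₃·S₂) < 0` (`Var = 17` is odd: the two surviving end coefficients have opposite signs). [folklore] -/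
theorem trace_bottom_mul_trace_top_neg_of_nullNull_seventeen (d : Fin 4 → ℕ) (hd : StrictMono d) (S : Fin 4 → Matrix (Fin 3) (Fin 3) ℝ)
    (h0 : (S 0).det = 0) (h3 : (S 3).det = 0)
    (h17 : 17 ≤ ((Matrix.det (∑ l, ((X : ℝ[X]) ^ d l) • (S l).map C)).roots.toFinset.filter (fun t => 0 < t)).card) :
    ((S 0).adjugate * S 1).trace * ((S 3).adjugate * S 2).trace < 0 := by
  have h332 : Multiset.card ({3, 3, 2} : Multiset (Fin 4)) = 3 := by simp
  have h001 : Multiset.card ({0, 0, 1} : Multiset (Fin 4)) = 3 := by simp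
  set P := Matrix.det (∑ l, ((X : ℝ[X]) ^ d l) • (S l).map C) with hP
  have hsupp := support_det_pencil_eq_of_nullNull_seventeen d S h0 h3 h17
  have hmemE : Sym.replicate 3 (0 : Fin 4) ∈ (Finset.univ : Finset (Sym (Fin 4) 3)).erase (Sym.replicate 3 3) :=
    Finset.mem_erase.mpr ⟨by decide, Finset.mem_univ _⟩
  have hcard : P.support.card = 18 := by
    rw [hP, hsupp, Finset.card_image_iff.mpr (sym_sum_injOn_of_nullNull_seventeen d S h0 h3 h17),
      Finset.card_erase_of_mem hmemE, Finset.card_erase_of_mem (Finset.mem_univ _), Finset.card_univ, Sym.card_sym_eq_choose]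
    decide
  have hs1_3 : (⟨{0, 0, 1}, h001⟩ : Sym (Fin 4) 3) ≠ Sym.replicate 3 3 := sym_mk_ne_replicate h001 3 (by decide)
  have hs1_0 : (⟨{0, 0, 1}, h001⟩ : Sym (Fin 4) 3) ≠ Sym.replicate 3 0 := sym_mk_ne_replicate h001 0 (by decide)
  have hs2_3 : (⟨{3, 3, 2}, h332⟩ : Sym (Fin 4) 3) ≠ Sym.replicate 3 3 := sym_mk_ne_replicate h332 3 (by decide)
  have hs2_0 : (⟨{3, 3, 2}, h332⟩ : Sym (Fin 4) 3) ≠ Sym.replicate 3 0 := sym_mk_ne_replicate h332 0 (by decide)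
  -- coefficients at the two ends
  have hc1 : P.coeff (2 * d 0 + d 1) = ((S 0).adjugate * S 1).trace := by
    refine coeff_det_pencil_three_square d S (by decide : (0 : Fin 4) ≠ 1) fun f hf => ?_
    have h := sym_eq_of_sum_eq_of_nullNull_seventeen d hd S h0 h3 h17 _ hs1_3 hs1_0 f (hf.trans (sym_sum_001 d h001).symm)
    have hval : (Finset.univ.val.map f : Multiset (Fin 4)) = {0, 0, 1} := by
      have := congrArg (fun u : Sym (Fin 4) 3 => (u : Multiset (Fin 4))) h
      simpa using this
    exact fun_eq_of_map_univ_eq_pair 0 1 (by decide) f hval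
  have hc2 : P.coeff (2 * d 3 + d 2) = ((S 3).adjugate * S 2).trace := by
    refine coeff_det_pencil_three_square d S (by decide : (3 : Fin 4) ≠ 2) fun f hf => ?_
    have h := sym_eq_of_sum_eq_of_nullNull_seventeen d hd S h0 h3 h17 _ hs2_3 hs2_0 f (hf.trans (sym_sum_332 d h332).symm)
    have hval : (Finset.univ.val.map f : Multiset (Fin 4)) = {3, 3, 2} := by
      have := congrArg (fun u : Sym (Fin 4) 3 => (u : Multiset (Fin 4))) h
      simpa using this
    exact fun_eq_of_map_univ_eq_pair 3 2 (by decide) f hval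
  have hmem1 : 2 * d 0 + d 1 ∈ P.support := by
    rw [hP, hsupp]
    exact Finset.mem_image.mpr ⟨_, Finset.mem_erase.mpr ⟨hs1_0, Finset.mem_erase.mpr ⟨hs1_3, Finset.mem_univ _⟩⟩, sym_sum_001 d h001⟩
  have hmem2 : 2 * d 3 + d 2 ∈ P.support := by
    rw [hP, hsupp]
    exact Finset.mem_image.mpr ⟨_, Finset.mem_erase.mpr ⟨hs2_0, Finset.mem_erase.mpr ⟨hs2_3, Finset.mem_univ _⟩⟩, sym_sum_332 d h332⟩
  have hrank1 : (P.support.filter (fun c => c < 2 * d 0 + d 1)).card = 0 := by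
    rw [Finset.card_eq_zero, Finset.filter_eq_empty_iff]
    intro c hc
    rw [hP, hsupp] at hc
    obtain ⟨s, hs, rfl⟩ := Finset.mem_image.mp hc
    have hs0 : s ≠ Sym.replicate 3 0 := (Finset.mem_erase.mp hs).1
    by_cases hs1 : s = (⟨{0, 0, 1}, h001⟩ : Sym (Fin 4) 3)
    · subst hs1; exact fun hlt => lt_irrefl _ ((sym_sum_001 d h001).symm.trans_lt hlt)
    exact not_lt.mpr (subbottom_lt_sym_sum_of_strictMono d hd s hs0 (fun h => hs1 (Subtype.ext h))).le
  have hrank2 : (P.support.filter (fun c => c < 2 * d 3 + d 2)).card = 17 := by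
    have hfilt : P.support.filter (fun c => c < 2 * d 3 + d 2) = P.support.erase (2 * d 3 + d 2) := by
      ext c
      simp only [Finset.mem_filter, Finset.mem_erase]
      constructor
      · rintro ⟨hc, hlt⟩; exact ⟨Nat.ne_of_lt hlt, hc⟩
      · rintro ⟨hne, hc⟩
        refine ⟨hc, lt_of_le_of_ne ?_ hne⟩
        rw [hP, hsupp] at hc
        obtain ⟨s, hs, rfl⟩ := Finset.mem_image.mp hc
        exact sym_sum_le_subtop_of_strictMono d hd s (Finset.mem_erase.mp (Finset.mem_erase.mp hs).2).1
    rw [hfilt, Finset.card_erase_of_mem hmem2, hcard]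
  have key := pow_rank_mul_coeff_mul_coeff_pos_of_sharp P (by rw [hcard]; omega) hmem1 hmem2
  rw [hrank1, hrank2, hc1, hc2] at key
  norm_num at key
  linarith

/-- **HALF-SHEET CLOSURE of `stub_nullNullCeiling`.**  On a sorted support with `det S₀ = det S₃ = 0`: if `tr(adj S₀·S₁) · tr(adj S₃·S₂) ≥ 0` then
at most `16` distinct positive roots (any real letters). [folklore] -/
theorem posRoots_le_16_of_nullNull_of_endProduct_nonneg (d : Fin 4 → ℕ) (hd : StrictMono d) (S : Fin 4 → Matrix (Fin 3) (Fin 3) ℝ)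
    (h0 : (S 0).det = 0) (h3 : (S 3).det = 0) (hsign : 0 ≤ ((S 0).adjugate * S 1).trace * ((S 3).adjugate * S 2).trace) :
    ((Matrix.det (∑ l, ((X : ℝ[X]) ^ d l) • (S l).map C)).roots.toFinset.filter (fun t => 0 < t)).card ≤ 16 := by
  by_contra h
  have := trace_bottom_mul_trace_top_neg_of_nullNull_seventeen d hd S h0 h3 (by omega)
  linarith

/-- **Stub-shaped packaging.**  `stub_nullTopCeiling` HOLDS for symmetric letters (unused) on the closed half-sheet `det S₀·tr(adj S₃·S₂) ≤ 0`, and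
`stub_nullNullCeiling` on `tr(adj S₀·S₁)·tr(adj S₃·S₂) ≥ 0`. [folklore] -/
theorem nullCeilings_on_halfSheets (d : Fin 4 → ℕ) (S : Fin 4 → Matrix (Fin 3) (Fin 3) ℝ) (_hS : ∀ l, (S l).IsSymm) (hd : StrictMono d)
    (h3 : (S 3).det = 0) :
    ((S 0).det * ((S 3).adjugate * S 2).trace ≤ 0 →
      ((∑ l, (Polynomial.X : Polynomial ℝ) ^ d l • (S l).map Polynomial.C).det.roots.toFinset.filter (fun t => 0 < t)).card ≤ 17) ∧
    ((S 0).det = 0 → 0 ≤ ((S 0).adjugate * S 1).trace * ((S 3).adjugate * S 2).trace →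
      ((∑ l, (Polynomial.X : Polynomial ℝ) ^ d l • (S l).map Polynomial.C).det.roots.toFinset.filter (fun t => 0 < t)).card ≤ 16) :=
  ⟨fun hsign => posRoots_le_17_of_nullTop_of_endProduct_nonpos d hd S h3 hsign,
   fun h0 hsign => posRoots_le_16_of_nullNull_of_endProduct_nonneg d hd S h0 h3 hsign⟩

end Summit.ValiantsHypothesis.ValiantsHypothesis.Theorems.LacunarySymmetroidMatrixDescartes.Census
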